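import Literature.Probability.LatticeModels.TemperleyLiebCapSpan
import HarnessLib

/-!
# Every link pattern of at least four sites carries a nearest-neighbour chord away from the last pair: the planar module is the sum of the images of the INITIAL cap insertions («TL-CAP-SPAN-INITIAL»)

Topic `Literature/Probability/LatticeModels`; a rider on `TemperleyLiebCapSpan.lean` («TL-CAP-SPAN»: ★ `LinkPattern.exists_adjacent` — every link pattern of `n + 2`
sites pairs some `j` with `j + 1`; `exists_eq_capIns`; ★★ `iSup_range_capInsL_eq_top`; ★★★ `span_eq_top_of_capInsL_mem_span` — the inductive spanning criterion over
ALL `n + 1` cap positions of the module of `n + 2` sites) and on `TemperleyLiebCapContract.lean` (`skip`, `capIns`, `contractSucc`, `eq_capIns_contractSucc`,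
`capIns_partner_skip`, `capInsL`).

The same elementary planarity fact, sharpened by one position: a system of non-intersecting half-loops on `n + 4 ≥ 4` sites has a nearest-neighbour chord `{j, j+1}`
with `j + 1` NOT the last site — if the only nearest-neighbour chord were the last pair `{n+2, n+3}`, the remaining `n + 2 ≥ 2` sites would carry a non-intersecting system
without any nearest-neighbour chord, which is impossible (Pearce–Rittenberg–de Gier–Nienhuis 2002, §2: the link patterns). In the lineage's coordinates (cap positions
`Fin (n + 3)` for the module of `n + 4` sites; the INITIAL positions are `Fin.castSucc j`, `j : Fin (n + 2)`, i.e. the caps `{j, j+1}` with `j + 1 ≤ n + 2`):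

* ★ `LinkPattern.exists_adjacent_castSucc` — every link pattern of `n + 4` sites pairs `j` with `j + 1` for some INITIAL position `j` (apply `exists_adjacent` to the pattern
  and, if the chord found is the last pair, to its contraction at the last position — the chord of the contraction is not moved by `skip (Fin.last _)`);
* ★ `LinkPattern.exists_eq_capIns_castSucc` — every link pattern of `n + 4` sites is `capIns (Fin.castSucc j) P` for an initial `j` and a pattern `P` of `n + 2` sites;
* ★★ `eq_top_of_forall_range_capInsL_castSucc_le` / `iSup_range_capInsL_castSucc_eq_top` — **THE PLANAR MODULE OF `n + 4` SITES IS THE SUM OF THE IMAGES OF THE `n + 2`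
  INITIAL CAP INSERTIONS** `capInsL (Fin.castSucc j) : V_{n+2} → V_{n+4}` (the insertion at the last position is not needed);
* ★★★ `span_eq_top_of_capInsL_castSucc_mem_span` — **THE INDUCTIVE SPANNING CRITERION WITH INITIAL CAPS ONLY**: if for every initial position `j` a family `g j` spans
  the planar module of `n + 2` sites and the cap insertions `capInsL (Fin.castSucc j) (g j k)` all lie in the span of a family `f` of vectors of the module of `n + 4` sites,
  then `f` spans it.

Why the lane wants it (HOME `FINDING-BSPAN-TOWER-IDENTITY.md` §4 (S3), `FINDING-BSPAN-SLIDE-INDUCTION.md`): in the induction on the number of marks for boundary span, the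
boundary law `lawLP z` of a `(k+1)`-point configuration space lists the `k` CORNERS first and the observation mid-edge `z` LAST; the one-hexagon decomposition F1 realises
cap insertions between consecutive corners (two new marked corners on an attached hexagon) — never a cap after `z`. So the Percolation-side criterion
(`MarkedLoopBoundarySpanInduction.lean`) must be fed with the initial positions only; this file is the algebraic half of that sharpening (cf. the sister sharpening
`TemperleyLiebPercolationHeadInitial.lean` of the head theorem to the initial generators).

## References
* P. A. Pearce, V. Rittenberg, J. de Gier, B. Nienhuis, *Temperley–Lieb stochastic processes*, J. Phys. A 35 (2002) L661–L668, §2 (link patterns = non-intersecting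
  half-loops; the monoid move).

## Mathlib / tree
Tree: `TemperleyLiebCapSpan.lean` (`LinkPattern.exists_adjacent`, `eq_capIns_contractSucc`, `eq_top_of_forall_single_mem'`), `TemperleyLiebCapContract.lean`
(`skip_val`, `capIns_partner_skip`, `LinkPattern.capIns`, `contractSucc`, `capInsL`, `capInsL_single`). Mathlib: `Submodule.span_induction`, `LinearMap.mem_range`,
`le_iSup`, `Fin.val_castSucc`, `Fin.val_succ`, `Fin.val_last`.
-/

namespace Literature.Probability.LatticeModels.TemperleyLieb

open Function

namespace LinkPattern

variable {n : ℕ}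

/-- ★ **every link pattern of at least four sites has a nearest-neighbour chord `{j, j+1}` with `j + 1` not the last site** (an INITIAL cap position
`Fin.castSucc j`, `j : Fin (n + 2)`): either the nearest-neighbour chord of `exists_adjacent` is initial, or it is the last pair and the contraction at the last position — a
link pattern of `n + 2 ≥ 2` sites — has a nearest-neighbour chord of its own, which `skip (Fin.last _)` leaves in place.
[cite: PearceRittenbergDeGierNienhuis2002, §2 (non-intersecting half-loops)] -/
theorem exists_adjacent_castSucc (Q : LinkPattern (n + 1 + 1 + 1 + 1)) :
    ∃ j : Fin (n + 1 + 1), Q.1.partner (Fin.castSucc (Fin.castSucc j)) = (Fin.castSucc j).succ := by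
  obtain ⟨j₀, hj₀⟩ := Q.exists_adjacent
  by_cases hlt : j₀.val < n + 1 + 1
  · -- the chord found is already initial
    refine ⟨⟨j₀.val, hlt⟩, ?_⟩
    have e : Fin.castSucc (⟨j₀.val, hlt⟩ : Fin (n + 1 + 1)) = j₀ := Fin.ext rfl
    rw [e, hj₀]
  · -- the chord found is the last pair: contract there and use the chord of the contraction
    have hj₀v : j₀.val = n + 1 + 1 := by have := j₀.2; omega
    obtain ⟨j₁, hj₁⟩ := (Q.contractSucc j₀).exists_adjacent
    have hQ : Q = (Q.contractSucc j₀).capIns j₀ := Q.eq_capIns_contractSucc hj₀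
    refine ⟨⟨j₁.val, by have := j₁.2; omega⟩, ?_⟩
    -- the two sites of the chord of the contraction are below `j₀`, so `skip j₀` does not move them
    have hs1 : skip j₀ (Fin.castSucc j₁) = Fin.castSucc (Fin.castSucc (⟨j₁.val, by have := j₁.2; omega⟩ : Fin (n + 1 + 1))) := by
      apply Fin.ext
      rw [skip_val, Fin.val_castSucc, Fin.val_castSucc, Fin.val_castSucc, if_pos (by have := j₁.2; omega)]
    have hs2 : skip j₀ j₁.succ = (Fin.castSucc (⟨j₁.val, by have := j₁.2; omega⟩ : Fin (n + 1 + 1))).succ := by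
      apply Fin.ext
      rw [skip_val, Fin.val_succ, Fin.val_succ, Fin.val_castSucc, if_pos (by have := j₁.2; omega)]
    rw [← hs1, ← hs2, hQ]
    show (PerfectMatching.capIns j₀ (Q.contractSucc j₀).1).partner (skip j₀ (Fin.castSucc j₁)) = skip j₀ j₁.succ
    rw [PerfectMatching.capIns_partner_skip, hj₁]

/-- ★ **every link pattern of `n + 4` sites is a cap insertion at an INITIAL position** `capIns (Fin.castSucc j) P`, `j : Fin (n + 2)`.
[cite: PearceRittenbergDeGierNienhuis2002, §2 (non-intersecting half-loops)] -/
theorem exists_eq_capIns_castSucc (Q : LinkPattern (n + 1 + 1 + 1 + 1)) :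
    ∃ (j : Fin (n + 1 + 1)) (P : LinkPattern (n + 1 + 1)), Q = P.capIns (Fin.castSucc j) := by
  obtain ⟨j, hj⟩ := Q.exists_adjacent_castSucc
  exact ⟨j, Q.contractSucc (Fin.castSucc j), Q.eq_capIns_contractSucc hj⟩

end LinkPattern

/-! ### The planar module is the sum of the images of the initial cap insertions -/

section CapSpanInitial

variable {R : Type*} [CommRing R] {n : ℕ}

/-- ★★ **a subspace of the planar module of `n + 4` sites containing the image of every INITIAL cap insertion `capInsL (Fin.castSucc j)`, `j : Fin (n + 2)`, is
everything** (the insertion at the last position is not needed). [cite: PearceRittenbergDeGierNienhuis2002, §2 (non-intersecting half-loops)] -/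
theorem eq_top_of_forall_range_capInsL_castSucc_le {W : Submodule R (LinkPattern (n + 1 + 1 + 1 + 1) →₀ R)}
    (h : ∀ j : Fin (n + 1 + 1), LinearMap.range (capInsL R (Fin.castSucc j) (n := n + 1 + 1)) ≤ W) : W = ⊤ := by
  refine eq_top_of_forall_single_mem' fun Q => ?_
  obtain ⟨j, P, rfl⟩ := Q.exists_eq_capIns_castSucc
  refine h j ⟨Finsupp.single P 1, ?_⟩
  rw [capInsL_single]

/-- ★★ **THE PLANAR MODULE OF `n + 4` SITES IS THE SUM OF THE IMAGES OF THE `n + 2` INITIAL CAP INSERTIONS**: `⨆_{j < n+2} range (capInsL (Fin.castSucc j)) = ⊤`.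
[cite: PearceRittenbergDeGierNienhuis2002, §2 (non-intersecting half-loops)] -/
theorem iSup_range_capInsL_castSucc_eq_top :
    (⨆ j : Fin (n + 1 + 1), LinearMap.range (capInsL R (Fin.castSucc j) (n := n + 1 + 1))) = ⊤ :=
  eq_top_of_forall_range_capInsL_castSucc_le fun j =>
    le_iSup (fun j : Fin (n + 1 + 1) => LinearMap.range (capInsL R (Fin.castSucc j) (n := n + 1 + 1))) j

/-- ★★★ **THE INDUCTIVE SPANNING CRITERION WITH INITIAL CAPS ONLY**: if for every initial position `j : Fin (n + 2)` a family `g j` spans the planar module of `n + 2`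
sites and the cap insertions `capInsL (Fin.castSucc j) (g j k)` all lie in the span of a family `f` of vectors of the module of `n + 4` sites, then `f` spans it.
[cite: PearceRittenbergDeGierNienhuis2002, §2 (non-intersecting half-loops; the monoid move)] -/
theorem span_eq_top_of_capInsL_castSucc_mem_span {ι : Type*} {κ : Fin (n + 1 + 1) → Type*} (f : ι → LinkPattern (n + 1 + 1 + 1 + 1) →₀ R)
    (g : ∀ j : Fin (n + 1 + 1), κ j → (LinkPattern (n + 1 + 1) →₀ R)) (hg : ∀ j, Submodule.span R (Set.range (g j)) = ⊤)
    (hf : ∀ j k, capInsL R (Fin.castSucc j) (g j k) ∈ Submodule.span R (Set.range f)) : Submodule.span R (Set.range f) = ⊤ := by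
  refine eq_top_of_forall_range_capInsL_castSucc_le fun j => ?_
  rintro _ ⟨x, rfl⟩
  have hx : x ∈ Submodule.span R (Set.range (g j)) := by rw [hg j]; exact Submodule.mem_top
  refine Submodule.span_induction ?_ ?_ ?_ ?_ hx
  · rintro _ ⟨k, rfl⟩; exact hf j k
  · rw [map_zero]; exact Submodule.zero_mem _
  · intro x y _ _ hx hy; rw [map_add]; exact Submodule.add_mem _ hx hy
  · intro c x _ hx; rw [map_smul]; exact Submodule.smul_mem _ c hx

/-- ★ **the whole-family form**: if a family `g` spans the module of `n + 2` sites and EVERY initial cap insertion of every member lies in the span of `f`, then `f` spans the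
module of `n + 4` sites. [cite: PearceRittenbergDeGierNienhuis2002, §2 (non-intersecting half-loops)] -/
theorem span_eq_top_of_capInsL_castSucc_mem_span' {ι κ : Type*} (f : ι → LinkPattern (n + 1 + 1 + 1 + 1) →₀ R) (g : κ → (LinkPattern (n + 1 + 1) →₀ R))
    (hg : Submodule.span R (Set.range g) = ⊤) (hf : ∀ (j : Fin (n + 1 + 1)) k, capInsL R (Fin.castSucc j) (g k) ∈ Submodule.span R (Set.range f)) :
    Submodule.span R (Set.range f) = ⊤ :=
  span_eq_top_of_capInsL_castSucc_mem_span f (fun _ => g) (fun _ => hg) hf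

end CapSpanInitial

end Literature.Probability.LatticeModels.TemperleyLieb
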